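import Summits.QuantumFields.YangMills.Theorems.UnitScaleTiltProp7FramedSecondDifference
import Summits.QuantumFields.YangMills.Theorems.UnitScaleTiltProp7CentrePinnedHessianPoincare
import Summits.QuantumFields.YangMills.Theorems.UnitScaleTiltProp7CovariantWeitzenbock
import HarnessLib

/-!
# Route `UnitScaleTilt`, crux K1 «MinimiserStabilityRegPr» (stmt-QuantumFields-19200), route-R E′ path (α′), S2 = P-cov2 (the COVARIANT (hK)), brick (D1-cov) FILE B1 —
# THE COVARIANT VERTEX-PINNED MORREY CELL INEQUALITY: on one corner-cell, in a local frame, the Hilbert–Schmidt mass of a matrix field vanishing at the 8 vertices is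
# bounded by `4N²·C_M·ℓ⁴ ×` the box sum of four FRAME-FREE covariant quantities — second covariant differences, `τ₁² ×` first covariant differences (shifted),
# `(2τ₂ + 4τ₁²)² ×` the field (shifted)

Cell `ym3-torus`, extra width seat `ym-routeR-w6` (gen 6); LOCATE `ym-routeR-w6/LOCATE-PCOV2-routeRw6g6.md` (19200 evidence #42) §2 STEPS 1–2.  THEOREMS ONLY (0 `def`, 0 `sorry`);
`--supports stmt-QuantumFields-19200`, count-neutral.  YM₃ on T³ is a ladder rung (R3), not the Clay problem; nothing here claims a stub, the crux, d = 4 or the mass gap.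

WHAT IS PROVED (ns `…Theorems.Prop7FramedHessianCell`; torus `Site P 0`, periodic lift `π z = (z_κ mod |T^{(0)}|)_κ` of `Zd P.d`, shifts `torusT P 0`, `hs X = Σ_{jk}‖X_jk‖²`).
* §1 `re_pdiff_pdiff_entry`∕`im_pdiff_pdiff_entry` (real components commute with flat second differences), ★★ `sum_cell_hs_le_hessian_hs` — the FLAT
  matrix-valued cell lemma: `f|_{8 vertices} = 0 ⇒ Σ_{cell} hs(f(πz)) ≤ C_M·s⁴·Σ_{z ∈ Q_{5s+1}} Σ_{μν} hs(∂_ν∂_μ f(πz))` (d = 3; ✓ `Prop7VertexPinnedMorreyCell.sum_sq_le_hessian_of_vanish_vertices`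
  on each of the `2N²` real components, ✓ `csq4_hessian_lift` at `c = 1`; `C_M = 24·289·24576·46116`).
* §2 ★★★ `sum_cell_hs_le_framed` — bi-contractive background `U`, field `e` vanishing at the 8 vertices, frame `Fr` (bi-contractive) with the framed-link rows of
  ✓ `Prop7FramedSecondDifference.norm_sq_sdiff_framed_le` at every `πz`, `z ∈ Q_{5s+1}`:
  `Σ_{cell} hs(e(πz)) ≤ 4N²·C_M·s⁴·Σ_{z∈Q_{5s+1}}Σ_{μν}[hs(D_νD_μe(x)) + 4τ₁²hs(D_μe(T_νx)) + 4τ₁²hs(D_νe(T_μx)) + (2τ₂+4τ₁²)²hs(e(T_μT_νx))]_{x = πz}` — NO frame on the right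
  (§1 for `v := R(Fr⁻¹)e`, HS ↔ operator norm by ✓ `sum_norm_sq_le_mul_opNorm_sq` ∕ ✓ `MatrixNorms.opNorm_sq_le_sum_norm_sq`, `‖e‖ = ‖R(Fr)v‖ ≤ ‖v‖`).
HONEST SCOPE.  One cell; the frame and its rows stay hypotheses (member: (3.35) cube gauges, ✓ `Prop7ConjFrameReg335`); the torus sum, the covariant Bochner step and the
absorption are FILE B2 (`…CentrePinnedHessianPoincareCov`).

References: M. Giaquinta, *Multiple integrals in the calculus of variations and nonlinear elliptic systems*, Princeton 1983 [Giaquinta1984] (Ch. III §1 Thm 1.2 pp.70–72);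
T. Bałaban, CMP 99 (1985) 389–434 [Balaban1985BackgroundPropagators] ((3.28) p.395, (3.35) p.396); CMP 102 (1985) 277–309 [Balaban1985Variational] (Prop. 7 p.299).
-/

set_option autoImplicit false

noncomputable section

open scoped BigOperators Matrix.Norms.L2Operator Matrix

namespace Summit.QuantumFields.YangMills.Theorems.Prop7FramedHessianCell

open Literature.MathematicalPhysics.QuantumFieldTheory.Balaban1983to89
open LatticeFieldCalculus
open B4Eq19LatticeOperators (Zd box gradSq fdiff)
open B9Eq39Adjoint (R R_R_inv covD)
open B9Eq310Hermitian (norm_R_le)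
open B9TorusCalculus (torusT torusT_apply torusT_comm)
open Summit.QuantumFields.YangMills.Theorems.Prop7VertexPinnedMorreyCell (sum_sq_le_hessian_of_vanish_vertices)
open Summit.QuantumFields.YangMills.Theorems.Prop7CentrePinnedHessianPoincare (csq4_hessian_lift)
open Summit.QuantumFields.YangMills.Theorems.Prop7CovariantCoercivity (sum_norm_sq_le_mul_opNorm_sq)
open Summit.QuantumFields.YangMills.Theorems.Prop7FramedSecondDifference (norm_sq_sdiff_framed_le)

variable {P : Params} {N : ℕ}

/-! ## §1 The flat matrix-valued cell lemma in Hilbert–Schmidt form -/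

/-- real parts of entries commute with the flat second difference. [folklore] -/
theorem re_pdiff_pdiff_entry (f : Site P 0 → Matrix (Fin N) (Fin N) ℂ) (μ ν : Fin P.d) (a b : Fin N) (x : Site P 0) :
    pdiff 1 ν (pdiff 1 μ (fun y => ((f y) a b).re)) x = ((pdiff 1 ν (pdiff 1 μ f) x) a b).re := by
  simp only [pdiff, one_smul, Matrix.sub_apply, Complex.sub_re]

/-- imaginary parts of entries commute with the flat second difference. [folklore] -/
theorem im_pdiff_pdiff_entry (f : Site P 0 → Matrix (Fin N) (Fin N) ℂ) (μ ν : Fin P.d) (a b : Fin N) (x : Site P 0) :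
    pdiff 1 ν (pdiff 1 μ (fun y => ((f y) a b).im)) x = ((pdiff 1 ν (pdiff 1 μ f) x) a b).im := by
  simp only [pdiff, one_smul, Matrix.sub_apply, Complex.sub_im]

/-- moving a double outer sum inside a triple sum: `Σ_a Σ_b Σ_{z∈S} Σ_μ Σ_ν g = Σ_{z∈S} Σ_μ Σ_ν Σ_a Σ_b g`. [folklore] -/
theorem sum_ab_comm₅ {α β γ δ η : Type*} [Fintype α] [Fintype β] [Fintype δ] [Fintype η] (S : Finset γ) (g : α → β → γ → δ → η → ℝ) :
    ∑ a, ∑ b, ∑ z ∈ S, ∑ μ, ∑ ν, g a b z μ ν = ∑ z ∈ S, ∑ μ, ∑ ν, ∑ a, ∑ b, g a b z μ ν := by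
  calc ∑ a, ∑ b, ∑ z ∈ S, ∑ μ, ∑ ν, g a b z μ ν = ∑ a, ∑ z ∈ S, ∑ b, ∑ μ, ∑ ν, g a b z μ ν :=
        Finset.sum_congr rfl fun a _ => Finset.sum_comm
    _ = ∑ z ∈ S, ∑ a, ∑ b, ∑ μ, ∑ ν, g a b z μ ν := Finset.sum_comm
    _ = ∑ z ∈ S, ∑ μ, ∑ ν, ∑ a, ∑ b, g a b z μ ν := Finset.sum_congr rfl fun z _ => by
        calc ∑ a, ∑ b, ∑ μ, ∑ ν, g a b z μ ν = ∑ a, ∑ μ, ∑ b, ∑ ν, g a b z μ ν := Finset.sum_congr rfl fun a _ => Finset.sum_comm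
          _ = ∑ μ, ∑ a, ∑ b, ∑ ν, g a b z μ ν := Finset.sum_comm
          _ = ∑ μ, ∑ ν, ∑ a, ∑ b, g a b z μ ν := Finset.sum_congr rfl fun μ _ => by
              calc ∑ a, ∑ b, ∑ ν, g a b z μ ν = ∑ a, ∑ ν, ∑ b, g a b z μ ν := Finset.sum_congr rfl fun a _ => Finset.sum_comm
                _ = ∑ ν, ∑ a, ∑ b, g a b z μ ν := Finset.sum_comm

/-- ★★ **THE FLAT VERTEX-PINNED MORREY CELL LEMMA, MATRIX-VALUED, HILBERT–SCHMIDT FORM** (d = 3): a matrix field on the torus whose periodic lift vanishes at the 8 vertices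
`w + sε` of the cell `w + [0,s]³` has `Σ_{cell} hs(f(πz)) ≤ C_M·s⁴·Σ_{z ∈ Q_{5s+1}(w)} Σ_{μν} hs((∂_ν∂_μ f)(πz))` — ✓ `sum_sq_le_hessian_of_vanish_vertices` on each real component.
[cite: Giaquinta1984, Ch. III §1 Thm 1.2 pp.70–72] -/
theorem sum_cell_hs_le_hessian_hs (hd : P.d = 3) (f : Site P 0 → Matrix (Fin N) (Fin N) ℂ) (w : Zd P.d) {s : ℕ} (hs : 1 ≤ s)
    (h0 : ∀ ε : Fin P.d → Fin 2, f (fun κ => (((w κ + (s : ℤ) * ((ε κ : ℕ) : ℤ) : ℤ)) : ZMod (P.sitesPerDir 0))) = 0) :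
    ∑ z ∈ Fintype.piFinset (fun i => Finset.Icc (w i) (w i + s)),
        ∑ a : Fin N, ∑ b : Fin N, ‖(f (fun κ => ((z κ : ℤ) : ZMod (P.sitesPerDir 0)))) a b‖ ^ 2
      ≤ (24 * 289 * 24576 * 46116 : ℝ) * (s : ℝ) ^ 4 *
          ∑ z ∈ box w (5 * (s : ℤ) + 1), ∑ μ : Fin P.d, ∑ ν : Fin P.d,
            ∑ a : Fin N, ∑ b : Fin N, ‖(pdiff 1 ν (pdiff 1 μ f) (fun κ => ((z κ : ℤ) : ZMod (P.sitesPerDir 0)))) a b‖ ^ 2 := by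
  classical
  -- per real component
  have hcomp : ∀ (u : SiteField P 0 ℝ), (∀ ε : Fin P.d → Fin 2, u (fun κ => (((w κ + (s : ℤ) * ((ε κ : ℕ) : ℤ) : ℤ)) : ZMod (P.sitesPerDir 0))) = 0) →
      ∑ z ∈ Fintype.piFinset (fun i => Finset.Icc (w i) (w i + s)), (u (fun κ => ((z κ : ℤ) : ZMod (P.sitesPerDir 0)))) ^ 2
        ≤ (24 * 289 * 24576 * 46116 : ℝ) * (s : ℝ) ^ 4 *
            ∑ z ∈ box w (5 * (s : ℤ) + 1), ∑ μ : Fin P.d, ∑ ν : Fin P.d, (pdiff 1 ν (pdiff 1 μ u) (fun κ => ((z κ : ℤ) : ZMod (P.sitesPerDir 0)))) ^ 2 := by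
    intro u hu
    have h := sum_sq_le_hessian_of_vanish_vertices hd (fun z : Zd P.d => u (fun κ => ((z κ : ℤ) : ZMod (P.sitesPerDir 0)))) w hs
      (fun ε => by simpa using hu ε)
    have hC := csq4_hessian_lift (1 : ℝ) u w (5 * (s : ℤ) + 1)
    rw [one_pow, one_mul] at hC
    rw [hC] at h
    exact h
  -- sum the `2N²` components
  have hre := fun a b => hcomp (fun y => ((f y) a b).re) (fun ε => by simp only [h0 ε, Matrix.zero_apply, Complex.zero_re])
  have him := fun a b => hcomp (fun y => ((f y) a b).im) (fun ε => by simp only [h0 ε, Matrix.zero_apply, Complex.zero_im])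
  calc ∑ z ∈ Fintype.piFinset (fun i => Finset.Icc (w i) (w i + s)),
        ∑ a : Fin N, ∑ b : Fin N, ‖(f (fun κ => ((z κ : ℤ) : ZMod (P.sitesPerDir 0)))) a b‖ ^ 2
      = ∑ a : Fin N, ∑ b : Fin N, (∑ z ∈ Fintype.piFinset (fun i => Finset.Icc (w i) (w i + s)),
          ((fun y => ((f y) a b).re) (fun κ => ((z κ : ℤ) : ZMod (P.sitesPerDir 0)))) ^ 2
        + ∑ z ∈ Fintype.piFinset (fun i => Finset.Icc (w i) (w i + s)),
          ((fun y => ((f y) a b).im) (fun κ => ((z κ : ℤ) : ZMod (P.sitesPerDir 0)))) ^ 2) := by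
        rw [Finset.sum_comm]
        refine Finset.sum_congr rfl fun a _ => ?_
        rw [Finset.sum_comm]
        refine Finset.sum_congr rfl fun b _ => ?_
        rw [← Finset.sum_add_distrib]
        exact Finset.sum_congr rfl fun z _ => by rw [Complex.sq_norm, Complex.normSq_apply]; ring
    _ ≤ ∑ a : Fin N, ∑ b : Fin N, ((24 * 289 * 24576 * 46116 : ℝ) * (s : ℝ) ^ 4 *
            ∑ z ∈ box w (5 * (s : ℤ) + 1), ∑ μ : Fin P.d, ∑ ν : Fin P.d,
              (pdiff 1 ν (pdiff 1 μ (fun y => ((f y) a b).re)) (fun κ => ((z κ : ℤ) : ZMod (P.sitesPerDir 0)))) ^ 2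
        + (24 * 289 * 24576 * 46116 : ℝ) * (s : ℝ) ^ 4 *
            ∑ z ∈ box w (5 * (s : ℤ) + 1), ∑ μ : Fin P.d, ∑ ν : Fin P.d,
              (pdiff 1 ν (pdiff 1 μ (fun y => ((f y) a b).im)) (fun κ => ((z κ : ℤ) : ZMod (P.sitesPerDir 0)))) ^ 2) :=
        Finset.sum_le_sum fun a _ => Finset.sum_le_sum fun b _ => add_le_add (hre a b) (him a b)
    _ = ∑ a : Fin N, ∑ b : Fin N, ((24 * 289 * 24576 * 46116 : ℝ) * (s : ℝ) ^ 4 *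
            ∑ z ∈ box w (5 * (s : ℤ) + 1), ∑ μ : Fin P.d, ∑ ν : Fin P.d,
              ‖(pdiff 1 ν (pdiff 1 μ f) (fun κ => ((z κ : ℤ) : ZMod (P.sitesPerDir 0)))) a b‖ ^ 2) := by
        refine Finset.sum_congr rfl fun a _ => Finset.sum_congr rfl fun b _ => ?_
        rw [← mul_add, ← Finset.sum_add_distrib]
        congr 1
        refine Finset.sum_congr rfl fun z _ => ?_
        rw [← Finset.sum_add_distrib]
        refine Finset.sum_congr rfl fun μ _ => ?_
        rw [← Finset.sum_add_distrib]
        refine Finset.sum_congr rfl fun ν _ => ?_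
        rw [re_pdiff_pdiff_entry, im_pdiff_pdiff_entry, Complex.sq_norm, Complex.normSq_apply]; ring
    _ = (24 * 289 * 24576 * 46116 : ℝ) * (s : ℝ) ^ 4 *
          ∑ z ∈ box w (5 * (s : ℤ) + 1), ∑ μ : Fin P.d, ∑ ν : Fin P.d,
            ∑ a : Fin N, ∑ b : Fin N, ‖(pdiff 1 ν (pdiff 1 μ f) (fun κ => ((z κ : ℤ) : ZMod (P.sitesPerDir 0)))) a b‖ ^ 2 := by
        rw [← sum_ab_comm₅ (box w (5 * (s : ℤ) + 1))
          (fun a b z μ ν => ‖(pdiff 1 ν (pdiff 1 μ f) (fun κ => ((z κ : ℤ) : ZMod (P.sitesPerDir 0)))) a b‖ ^ 2)]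
        rw [Finset.mul_sum]
        refine Finset.sum_congr rfl fun a _ => ?_
        rw [Finset.mul_sum]

/-! ## §2 ★★★ The covariant cell inequality: framed field, frame-free right side -/

/-- `hs X ≤ N·hs(R(Fr⁻¹)X)` for a bi-contractive `Fr` (`‖X‖ = ‖R(Fr)R(Fr⁻¹)X‖ ≤ ‖R(Fr⁻¹)X‖`, Frobenius ≤ `N·`operator², operator² ≤ Frobenius). [folklore] -/
theorem hs_le_mul_hs_R_inv {Fr : (Matrix (Fin N) (Fin N) ℂ)ˣ}
    (hFr : ‖(Fr : Matrix (Fin N) (Fin N) ℂ)‖ ≤ 1 ∧ ‖((Fr⁻¹ : (Matrix (Fin N) (Fin N) ℂ)ˣ) : Matrix (Fin N) (Fin N) ℂ)‖ ≤ 1) (X : Matrix (Fin N) (Fin N) ℂ) :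
    ∑ a : Fin N, ∑ b : Fin N, ‖X a b‖ ^ 2 ≤ N * ∑ a : Fin N, ∑ b : Fin N, ‖(R Fr⁻¹ X) a b‖ ^ 2 := by
  have h1 := sum_norm_sq_le_mul_opNorm_sq X
  have h2 : ‖X‖ ≤ ‖R Fr⁻¹ X‖ := by
    have := norm_R_le hFr.1 hFr.2 (R Fr⁻¹ X)
    rwa [R_R_inv] at this
  have h3 := MatrixNorms.opNorm_sq_le_sum_norm_sq (R Fr⁻¹ X)
  have h2' : ‖X‖ ^ 2 ≤ ‖R Fr⁻¹ X‖ ^ 2 := pow_le_pow_left₀ (norm_nonneg _) h2 2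
  calc _ ≤ (N : ℝ) * ‖X‖ ^ 2 := h1
    _ ≤ N * ∑ a : Fin N, ∑ b : Fin N, ‖(R Fr⁻¹ X) a b‖ ^ 2 := mul_le_mul_of_nonneg_left (h2'.trans h3) (Nat.cast_nonneg N)

/-- ★★★ **THE COVARIANT VERTEX-PINNED MORREY CELL INEQUALITY** (d = 3; see the module docstring).  Bi-contractive background `U` on the torus shifts, matrix field `e` whose
periodic lift vanishes at the 8 vertices `w + sε` of the cell, a bi-contractive frame `Fr` whose framed links `h_κ(z) = Fr(z)⁻¹·U_κ(z)·Fr(z+e_κ)` satisfy, at every lifted box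
point `x = πz`, `z ∈ Q_{5s+1}(w)`, and all `μ ν`: `‖h_ν(x) − 1‖, ‖h_μ(x) − 1‖, ‖h_ν(x+e_μ) − 1‖ ≤ τ₁`, `‖h_μ(x+e_ν) − h_μ(x)‖ ≤ τ₂`.  Then
`Σ_{cell} hs(e(πz)) ≤ 4N²·C_M·s⁴·Σ_{z∈Q_{5s+1}}Σ_{μν}[hs(D_νD_μe(x)) + 4τ₁²·hs(D_μe(x+e_ν)) + 4τ₁²·hs(D_νe(x+e_μ)) + (2τ₂+4τ₁²)²·hs(e(x+e_μ+e_ν))]_{x=πz}`.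
[cite: Giaquinta1984, Ch. III §1 Thm 1.2 pp.70–72; Balaban1985BackgroundPropagators, (3.28) p.395, (3.35) p.396] -/
theorem sum_cell_hs_le_framed (hd : P.d = 3) {U : Fin P.d → Site P 0 → (Matrix (Fin N) (Fin N) ℂ)ˣ}
    (hU : ∀ (κ : Fin P.d) (y : Site P 0), ‖(U κ y : Matrix (Fin N) (Fin N) ℂ)‖ ≤ 1 ∧ ‖(((U κ y)⁻¹ : (Matrix (Fin N) (Fin N) ℂ)ˣ) : Matrix (Fin N) (Fin N) ℂ)‖ ≤ 1)
    (e : Site P 0 → Matrix (Fin N) (Fin N) ℂ) (w : Zd P.d) {s : ℕ} (hs : 1 ≤ s)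
    (he0 : ∀ ε : Fin P.d → Fin 2, e (fun κ => (((w κ + (s : ℤ) * ((ε κ : ℕ) : ℤ) : ℤ)) : ZMod (P.sitesPerDir 0))) = 0)
    {Fr : Site P 0 → (Matrix (Fin N) (Fin N) ℂ)ˣ}
    (hFr : ∀ z : Site P 0, ‖(Fr z : Matrix (Fin N) (Fin N) ℂ)‖ ≤ 1 ∧ ‖(((Fr z)⁻¹ : (Matrix (Fin N) (Fin N) ℂ)ˣ) : Matrix (Fin N) (Fin N) ℂ)‖ ≤ 1)
    {τ₁ τ₂ : ℝ}
    (hrows : ∀ z ∈ box w (5 * (s : ℤ) + 1), ∀ μ ν : Fin P.d,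
      ‖(((Fr (fun κ => ((z κ : ℤ) : ZMod (P.sitesPerDir 0))))⁻¹ * U ν (fun κ => ((z κ : ℤ) : ZMod (P.sitesPerDir 0)))
          * Fr (torusT P 0 ν (fun κ => ((z κ : ℤ) : ZMod (P.sitesPerDir 0)))) : (Matrix (Fin N) (Fin N) ℂ)ˣ) : Matrix (Fin N) (Fin N) ℂ) - 1‖ ≤ τ₁
      ∧ ‖(((Fr (fun κ => ((z κ : ℤ) : ZMod (P.sitesPerDir 0))))⁻¹ * U μ (fun κ => ((z κ : ℤ) : ZMod (P.sitesPerDir 0)))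
          * Fr (torusT P 0 μ (fun κ => ((z κ : ℤ) : ZMod (P.sitesPerDir 0)))) : (Matrix (Fin N) (Fin N) ℂ)ˣ) : Matrix (Fin N) (Fin N) ℂ) - 1‖ ≤ τ₁
      ∧ ‖(((Fr (torusT P 0 μ (fun κ => ((z κ : ℤ) : ZMod (P.sitesPerDir 0)))))⁻¹ * U ν (torusT P 0 μ (fun κ => ((z κ : ℤ) : ZMod (P.sitesPerDir 0))))
          * Fr (torusT P 0 ν (torusT P 0 μ (fun κ => ((z κ : ℤ) : ZMod (P.sitesPerDir 0))))) : (Matrix (Fin N) (Fin N) ℂ)ˣ) : Matrix (Fin N) (Fin N) ℂ) - 1‖ ≤ τ₁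
      ∧ ‖(((Fr (torusT P 0 ν (fun κ => ((z κ : ℤ) : ZMod (P.sitesPerDir 0)))))⁻¹ * U μ (torusT P 0 ν (fun κ => ((z κ : ℤ) : ZMod (P.sitesPerDir 0))))
            * Fr (torusT P 0 μ (torusT P 0 ν (fun κ => ((z κ : ℤ) : ZMod (P.sitesPerDir 0))))) : (Matrix (Fin N) (Fin N) ℂ)ˣ) : Matrix (Fin N) (Fin N) ℂ)
          - (((Fr (fun κ => ((z κ : ℤ) : ZMod (P.sitesPerDir 0))))⁻¹ * U μ (fun κ => ((z κ : ℤ) : ZMod (P.sitesPerDir 0)))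
            * Fr (torusT P 0 μ (fun κ => ((z κ : ℤ) : ZMod (P.sitesPerDir 0)))) : (Matrix (Fin N) (Fin N) ℂ)ˣ) : Matrix (Fin N) (Fin N) ℂ)‖ ≤ τ₂) :
    ∑ z ∈ Fintype.piFinset (fun i => Finset.Icc (w i) (w i + s)),
        ∑ a : Fin N, ∑ b : Fin N, ‖(e (fun κ => ((z κ : ℤ) : ZMod (P.sitesPerDir 0)))) a b‖ ^ 2
      ≤ 4 * (N : ℝ) ^ 2 * (24 * 289 * 24576 * 46116 : ℝ) * (s : ℝ) ^ 4 *
          ∑ z ∈ box w (5 * (s : ℤ) + 1), ∑ μ : Fin P.d, ∑ ν : Fin P.d,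
            (∑ a : Fin N, ∑ b : Fin N, ‖(covD (torusT P 0) U ν (covD (torusT P 0) U μ e) (fun κ => ((z κ : ℤ) : ZMod (P.sitesPerDir 0)))) a b‖ ^ 2
              + 4 * τ₁ ^ 2 * ∑ a : Fin N, ∑ b : Fin N, ‖(covD (torusT P 0) U μ e (torusT P 0 ν (fun κ => ((z κ : ℤ) : ZMod (P.sitesPerDir 0))))) a b‖ ^ 2
              + 4 * τ₁ ^ 2 * ∑ a : Fin N, ∑ b : Fin N, ‖(covD (torusT P 0) U ν e (torusT P 0 μ (fun κ => ((z κ : ℤ) : ZMod (P.sitesPerDir 0))))) a b‖ ^ 2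
              + (2 * τ₂ + 4 * τ₁ ^ 2) ^ 2 *
                  ∑ a : Fin N, ∑ b : Fin N, ‖(e (torusT P 0 μ (torusT P 0 ν (fun κ => ((z κ : ℤ) : ZMod (P.sitesPerDir 0)))))) a b‖ ^ 2) := by
  classical
  set v : Site P 0 → Matrix (Fin N) (Fin N) ℂ := fun y => R (Fr y)⁻¹ (e y) with hv
  -- the framed field vanishes at the vertices
  have hv0 : ∀ ε : Fin P.d → Fin 2, v (fun κ => (((w κ + (s : ℤ) * ((ε κ : ℕ) : ℤ) : ℤ)) : ZMod (P.sitesPerDir 0))) = 0 := by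
    intro ε
    simp only [hv, he0 ε, B9Eq39Adjoint.R_def, mul_zero, zero_mul]
  -- §1 for `v`
  have hcell := sum_cell_hs_le_hessian_hs hd v w hs hv0
  -- left: `hs(e) ≤ N·hs(v)`
  have hL : ∑ z ∈ Fintype.piFinset (fun i => Finset.Icc (w i) (w i + s)),
        ∑ a : Fin N, ∑ b : Fin N, ‖(e (fun κ => ((z κ : ℤ) : ZMod (P.sitesPerDir 0)))) a b‖ ^ 2
      ≤ N * ∑ z ∈ Fintype.piFinset (fun i => Finset.Icc (w i) (w i + s)),
        ∑ a : Fin N, ∑ b : Fin N, ‖(v (fun κ => ((z κ : ℤ) : ZMod (P.sitesPerDir 0)))) a b‖ ^ 2 := by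
    rw [Finset.mul_sum]
    exact Finset.sum_le_sum fun z _ => hs_le_mul_hs_R_inv (hFr _) _
  -- right: pointwise, the flat Hessian of `v` is frame-free bounded (FILE A)
  have hpt : ∀ z ∈ box w (5 * (s : ℤ) + 1), ∀ μ ν : Fin P.d,
      ∑ a : Fin N, ∑ b : Fin N, ‖(pdiff 1 ν (pdiff 1 μ v) (fun κ => ((z κ : ℤ) : ZMod (P.sitesPerDir 0)))) a b‖ ^ 2
        ≤ N * (4 * (∑ a : Fin N, ∑ b : Fin N, ‖(covD (torusT P 0) U ν (covD (torusT P 0) U μ e) (fun κ => ((z κ : ℤ) : ZMod (P.sitesPerDir 0)))) a b‖ ^ 2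
              + 4 * τ₁ ^ 2 * ∑ a : Fin N, ∑ b : Fin N, ‖(covD (torusT P 0) U μ e (torusT P 0 ν (fun κ => ((z κ : ℤ) : ZMod (P.sitesPerDir 0))))) a b‖ ^ 2
              + 4 * τ₁ ^ 2 * ∑ a : Fin N, ∑ b : Fin N, ‖(covD (torusT P 0) U ν e (torusT P 0 μ (fun κ => ((z κ : ℤ) : ZMod (P.sitesPerDir 0))))) a b‖ ^ 2
              + (2 * τ₂ + 4 * τ₁ ^ 2) ^ 2 *
                  ∑ a : Fin N, ∑ b : Fin N, ‖(e (torusT P 0 μ (torusT P 0 ν (fun κ => ((z κ : ℤ) : ZMod (P.sitesPerDir 0)))))) a b‖ ^ 2)) := by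
    intro z hz μ ν
    set x : Site P 0 := fun κ => ((z κ : ℤ) : ZMod (P.sitesPerDir 0)) with hx
    obtain ⟨h1ν, h1μ, h1ν', h2⟩ := hrows z hz μ ν
    have hτ₁ : 0 ≤ τ₁ := (norm_nonneg _).trans h1ν
    have hA := norm_sq_sdiff_framed_le (torusT P 0) U Fr hU hFr e μ ν x (torusT_comm μ ν x) h1ν h1μ h1ν' h2
    -- the flat second difference of `v` is FILE A's left side
    have hF : pdiff 1 ν (pdiff 1 μ v) x
        = (R (Fr (torusT P 0 μ (torusT P 0 ν x)))⁻¹ (e (torusT P 0 μ (torusT P 0 ν x))) - R (Fr (torusT P 0 ν x))⁻¹ (e (torusT P 0 ν x)))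
          - (R (Fr (torusT P 0 μ x))⁻¹ (e (torusT P 0 μ x)) - R (Fr x)⁻¹ (e x)) := by
      simp only [pdiff, one_smul, hv, torusT_apply]
    have hhs := sum_norm_sq_le_mul_opNorm_sq (pdiff 1 ν (pdiff 1 μ v) x)
    rw [hF] at hhs ⊢
    refine hhs.trans (mul_le_mul_of_nonneg_left (hA.trans ?_) (Nat.cast_nonneg N))
    -- operator² ≤ Frobenius on each of the four terms
    have o1 := MatrixNorms.opNorm_sq_le_sum_norm_sq (covD (torusT P 0) U ν (covD (torusT P 0) U μ e) x)
    have o2 := MatrixNorms.opNorm_sq_le_sum_norm_sq (covD (torusT P 0) U μ e (torusT P 0 ν x))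
    have o3 := MatrixNorms.opNorm_sq_le_sum_norm_sq (covD (torusT P 0) U ν e (torusT P 0 μ x))
    have o4 := MatrixNorms.opNorm_sq_le_sum_norm_sq (e (torusT P 0 μ (torusT P 0 ν x)))
    have hτ₁2 : 0 ≤ 4 * τ₁ ^ 2 := by positivity
    have hτ : 0 ≤ (2 * τ₂ + 4 * τ₁ ^ 2) ^ 2 := sq_nonneg _
    gcongr
  -- assemble
  have hK0 : 0 ≤ (24 * 289 * 24576 * 46116 : ℝ) * (s : ℝ) ^ 4 := by positivity
  calc _ ≤ N * ∑ z ∈ Fintype.piFinset (fun i => Finset.Icc (w i) (w i + s)),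
          ∑ a : Fin N, ∑ b : Fin N, ‖(v (fun κ => ((z κ : ℤ) : ZMod (P.sitesPerDir 0)))) a b‖ ^ 2 := hL
    _ ≤ N * ((24 * 289 * 24576 * 46116 : ℝ) * (s : ℝ) ^ 4 *
          ∑ z ∈ box w (5 * (s : ℤ) + 1), ∑ μ : Fin P.d, ∑ ν : Fin P.d,
            ∑ a : Fin N, ∑ b : Fin N, ‖(pdiff 1 ν (pdiff 1 μ v) (fun κ => ((z κ : ℤ) : ZMod (P.sitesPerDir 0)))) a b‖ ^ 2) :=
        mul_le_mul_of_nonneg_left hcell (Nat.cast_nonneg N)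
    _ ≤ N * ((24 * 289 * 24576 * 46116 : ℝ) * (s : ℝ) ^ 4 *
          ∑ z ∈ box w (5 * (s : ℤ) + 1), ∑ μ : Fin P.d, ∑ ν : Fin P.d,
            (N * (4 * (∑ a : Fin N, ∑ b : Fin N, ‖(covD (torusT P 0) U ν (covD (torusT P 0) U μ e) (fun κ => ((z κ : ℤ) : ZMod (P.sitesPerDir 0)))) a b‖ ^ 2
              + 4 * τ₁ ^ 2 * ∑ a : Fin N, ∑ b : Fin N, ‖(covD (torusT P 0) U μ e (torusT P 0 ν (fun κ => ((z κ : ℤ) : ZMod (P.sitesPerDir 0))))) a b‖ ^ 2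
              + 4 * τ₁ ^ 2 * ∑ a : Fin N, ∑ b : Fin N, ‖(covD (torusT P 0) U ν e (torusT P 0 μ (fun κ => ((z κ : ℤ) : ZMod (P.sitesPerDir 0))))) a b‖ ^ 2
              + (2 * τ₂ + 4 * τ₁ ^ 2) ^ 2 *
                  ∑ a : Fin N, ∑ b : Fin N, ‖(e (torusT P 0 μ (torusT P 0 ν (fun κ => ((z κ : ℤ) : ZMod (P.sitesPerDir 0)))))) a b‖ ^ 2)))) := by
        refine mul_le_mul_of_nonneg_left (mul_le_mul_of_nonneg_left ?_ hK0) (Nat.cast_nonneg N)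
        exact Finset.sum_le_sum fun z hz => Finset.sum_le_sum fun μ _ => Finset.sum_le_sum fun ν _ => hpt z hz μ ν
    _ = _ := by
        simp only [Finset.mul_sum]
        refine Finset.sum_congr rfl fun z _ => Finset.sum_congr rfl fun μ _ => Finset.sum_congr rfl fun ν _ => ?_
        ring

end Summit.QuantumFields.YangMills.Theorems.Prop7FramedHessianCell

end
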